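import Summits.ResolutionOfSingularities.ResolutionOfSingularities.Theorems.EquisingularLiftEquisingularLiftNatNoseTowerBTriplePrimeSpecimens
import Literature.AlgebraicGeometry.Resolution.ComponentGluing
import Literature.AlgebraicGeometry.Motives.SmoothHypersurfaceIrreducible
import Summits.ResolutionOfSingularities.ResolutionOfSingularities.Theorems.EquisingularLiftEquisingularLiftNatSpecimenCiNoseInstances
import HarnessLib

/-!
# [OURS · L1 W4.5(b) · EL♮(3)] NOSE ENGINE CERTIFICATION ‖ K — the DOUBLE-LINE CERTIFICATE SCHEMA: `ReachNoseTowerBTriplePrime` for ANY prime form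
# `F ∈ (x₂, x₃)` with `x₂ ∉ (F)` whose hypersurface has regular blow-ups along `𝓘_Σ · 𝒪_H` (kill-map-free interface; every field)

Cell `res-hironaka`, slot W4.5(b); crux **EL♮(3)** (stmt-ResolutionOfSingularities-20148); width seat res-L1-w45b-nose-w3, row «NOSE ENGINE CERT ‖ K» of
res-L1-w45b-plan-1's WIDTH TABLE D1′. `--supports stmt-ResolutionOfSingularities-20148 --as helper`; closes nothing. OURS; NOT a statement of any
manuscript; AI-written, weaker than expert review. No definition, no `sorry`, standard axioms.

WHY. Both kernel instances of the B‴ nose predicate so far (R2 `WhitneyCubic.reachNoseTowerBTriplePrime_whitneyCubic`, p642717; the cuspidal cubic cone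
`CuspCone.reachNoseTowerBTriplePrime_cuspCone`, `…NatSpecimenCuspConeCharts`) repeat the same ~40 lines of kill-map plumbing around res-D-pv-013's
`Σ = V(x₂, x₃)` lemmas. This file packages them ONCE, behind a kill-map-free hypothesis, so that the next double-line specimen (nodal cubic cone, C0a-type
scrolls after a coordinate change, …) is certified by its chart algebra ALONE:

* `DoubleLine.isIntegral_hypersurface_of_prime` — `V₊(F)` is integral for a prime form `F` (any `n`; pv-022's R2 argument, generic);
* `DoubleLine.subset_range_of_mem_span`, `DoubleLine.not_range_subset_of_notMem` — `Σ ⊆ ι(H)` from `F ∈ (x₂, x₃)`, `ι(H) ⊄ Σ` from `x₂ ∉ (F)`;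
* ★ **`DoubleLine.reachNoseTowerBTriplePrime_of_isRegular_blowups`** — for `F ∈ k[x₀,…,x₃]` homogeneous of positive degree, prime, `F ∈ (x₂, x₃)`, `x₂ ∉ (F)`, and
  «every blow-up of `H = V₊(F)` along `𝓘⟨Σ⟩ · 𝒪_H` is regular» (`IsBlowup ρ ((vanishingIdeal ⟨Σ, _⟩).comap ι) → IsRegular`): `ReachNoseTowerBTriplePrime K 3 H ι`
  — by the zero-round schema `reachNoseTowerBTriplePrime_of_oneBlowup` (p642717) with `Z = Σ` class₂ (`base ∘ SkewLines.line_isLiftableNoseClass`), the line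
  clauses `WhitneyCubic.doubleLine_infinite/curve`, a blow-up of `𝓘⟨Σ⟩ = ker Proj(f_K)` (pv-013) and `LinearCentre.isRegular_reducedStrictTransform_of_blowupModel`;
* `DoubleLine.ciNoseThenPoints_hypothesis_of_isRegular_blowups` — under the same hypotheses, the downstairs `∃ (c, f, d, …)` block of the REGISTERED rung
  `stub_elnat_ciNoseThenPoints` at `n = 3` (`c = 2`, `f = (x₂, x₃)`, zero point steps; pv-013's R2 certificate made generic);
* ★ **`DoubleLine.elNatAt_of_isRegular_blowups`** — hence, for `K` algebraically closed of characteristic `p` and all four dehomogenisations `F(x_c := 1)` spanning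
  radical ideals (the locally-principal binder, `HypersurfaceSpecimen.locallyPrincipal_hypersurfaceι`), **`ELNatAt p K 3 H ι`** through the landed rung (p524326)
  and `elNatAt_of_horizAt`: EL♮ for every such double-line hypersurface is ONE chart-algebra computation away.
-/

set_option linter.dupNamespace false -- mandated namespace `Summit.<Summit>.<Problem>` of this single-conjunct summit

noncomputable section

open CategoryTheory CategoryTheory.Limits AlgebraicGeometry TopologicalSpace
open MvPolynomial HomogeneousLocalization
open Literature.AlgebraicGeometry.Resolution
open Literature.AlgebraicGeometry.Motives Literature.AlgebraicGeometry.Motives.SmoothHypersurface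
open Literature.AlgebraicGeometry.Motives.ProjectiveSpace
open AlgebraicGeometry.Scheme.IdealSheafData

namespace Summit.ResolutionOfSingularities.ResolutionOfSingularities.Cruxes.EquisingularLiftNat.Sections

namespace DoubleLine

variable (K : Type) [Field K]

attribute [local instance] MvPolynomial.gradedAlgebra ProjBaseChange.algebraBase

/-- **`V₊(F)` is an integral scheme for a prime form `F`** (irreducible: Hartshorne II Ex. 2.9, tree `isIrreducible_zeroLocus_of_prime`; reduced by
construction). R2's argument, stated for an arbitrary prime form in four variables. [folklore] -/
theorem isIntegral_hypersurface_of_prime (F : MvPolynomial (Fin 4) K) {e : ℕ} (hF : F.IsHomogeneous e) (hprime : Prime F) :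
    AlgebraicGeometry.IsIntegral (hypersurface F).left := by
  haveI : AlgebraicGeometry.IsReduced (hypersurface F).left :=
    Literature.AlgebraicGeometry.Resolution.ComponentGluing.isReduced_subscheme_vanishingIdeal (zeroLocusClosed F)
  have hirr : IsIrreducible (Set.range (hypersurfaceι F).left) := by
    rw [range_hypersurfaceι]
    exact isIrreducible_zeroLocus_of_prime _ hF hprime
  haveI : IrreducibleSpace (Set.range (hypersurfaceι F).left) := Subtype.irreducibleSpace hirr
  haveI : IrreducibleSpace (hypersurface F).left :=
    (hypersurfaceι F).left.isClosedEmbedding.isEmbedding.toHomeomorph.irreducibleSpace_iff.mpr this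
  exact AlgebraicGeometry.isIntegral_of_irreducibleSpace_of_isReduced _

/-- `Σ = V(x₂, x₃) ⊆ ι(H)` whenever `F ∈ (x₂, x₃)`. [folklore] -/
theorem subset_range_of_mem_span (F : MvPolynomial (Fin 4) K)
    (hmem : F ∈ Ideal.span {(X 2 : MvPolynomial (Fin 4) K), X 3}) :
    {y : (Literature.AlgebraicGeometry.Motives.projectiveSpace 3 K).left |
      ∀ i, (![X 2, X 3] : Fin 2 → MvPolynomial (Fin (3 + 1)) K) i ∈
        (y : ProjectiveSpectrum (MvPolynomial.homogeneousSubmodule (Fin (3 + 1)) K)).asHomogeneousIdeal} ⊆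
      Set.range (hypersurfaceι F).left := by
  intro y hy
  have h2 : (X 2 : MvPolynomial (Fin (3 + 1)) K) ∈ y.asHomogeneousIdeal := hy 0
  have h3 : (X 3 : MvPolynomial (Fin (3 + 1)) K) ∈ y.asHomogeneousIdeal := hy 1
  refine (Set.ext_iff.mp (range_hypersurfaceι F) y).mpr
    ((ProjectiveSpectrum.mem_zeroLocus _ _ _).mpr (Set.singleton_subset_iff.mpr ?_))
  change F ∈ y.asHomogeneousIdeal
  have hle : Ideal.span {(X 2 : MvPolynomial (Fin 4) K), X 3} ≤ y.asHomogeneousIdeal.toIdeal := by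
    rw [Ideal.span_le]
    rintro g (rfl | rfl)
    · exact h2
    · exact h3
  exact hle hmem

/-- `ι(H) ⊄ Σ` whenever `x₂ ∉ (F)` (the generic point `(F)` of `H` lies in `D₊(x₂)`). [folklore] -/
theorem not_range_subset_of_notMem (F : MvPolynomial (Fin 4) K) {e : ℕ} (hF : F.IsHomogeneous e) (hprime : Prime F)
    (hX2 : (X 2 : MvPolynomial (Fin 4) K) ∉ Ideal.span {F}) :
    ¬ (Set.range (hypersurfaceι F).left ⊆
      {y : (Literature.AlgebraicGeometry.Motives.projectiveSpace 3 K).left |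
      ∀ i, (![X 2, X 3] : Fin 2 → MvPolynomial (Fin (3 + 1)) K) i ∈
        (y : ProjectiveSpectrum (MvPolynomial.homogeneousSubmodule (Fin (3 + 1)) K)).asHomogeneousIdeal}) := by
  intro h
  have hmem : (pointOfPrime F hF hprime : Proj (homogeneousSubmodule (Fin (3 + 1)) K)) ∈ Set.range (hypersurfaceι F).left := by
    refine (Set.ext_iff.mp (range_hypersurfaceι F) _).mpr
      ((ProjectiveSpectrum.mem_zeroLocus _ _ _).mpr (Set.singleton_subset_iff.mpr ?_))
    exact Ideal.subset_span rfl
  exact hX2 ((h hmem) 0)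

/-- **THE DOUBLE-LINE CERTIFICATE SCHEMA** (any field `K`): a hypersurface `H = V₊(F) ⊂ ℙ³_K` with `F` homogeneous of positive degree and PRIME,
`F ∈ (x₂, x₃)` (so `Σ = V(x₂, x₃) ⊆ ι(H)`), `x₂ ∉ (F)` (so `ι(H) ⊄ Σ`), all of whose blow-ups along `𝓘⟨Σ⟩ · 𝒪_H` are regular, satisfies
`ReachNoseTowerBTriplePrime K 3 H ι` with the nose `Σ`, ONE blow-up and an EMPTY round phase. Kill-map plumbing inside: `𝓘⟨Σ⟩ = ker Proj(f_K)` (pv-013),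
the reduced strict transform is regular (`LinearCentre.isRegular_reducedStrictTransform_of_blowupModel`), then the zero-round schema (p642717).
[OURS · L1 W4.5b] -/
theorem reachNoseTowerBTriplePrime_of_isRegular_blowups (F : MvPolynomial (Fin 4) K) {e : ℕ} (hF : F.IsHomogeneous e) (hprime : Prime F)
    (hmem : F ∈ Ideal.span {(X 2 : MvPolynomial (Fin 4) K), X 3})
    (hX2 : (X 2 : MvPolynomial (Fin 4) K) ∉ Ideal.span {F})
    (hreg : ∀ (Z : Scheme.{0}) (ρ : Z ⟶ (hypersurface F).left),
      IsBlowup ρ ((vanishingIdeal (⟨_, WhitneyCubic.isClosed_doubleLine K⟩ :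
        Closeds (Literature.AlgebraicGeometry.Motives.projectiveSpace 3 K).left)).comap (hypersurfaceι F).left) →
      Scheme.IsRegular Z) :
    ReachNoseTowerBTriplePrime K 3 (hypersurface F).left (hypersurfaceι F).left := by
  classical
  obtain ⟨fk, hfk', hfkC, hfkX⟩ := EquisingularLift.StrataSplit.LinearCentre.exists_kill K 1 2
  haveI := isIntegral_hypersurface_of_prime K F hF hprime
  haveI : IsLocallyNoetherian (Literature.AlgebraicGeometry.Motives.projectiveSpace (2 + 1) K).left :=
    EquisingularLift.StrataSplit.LinearCentre.isLocallyNoetherian_proj K (1 + 2)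
  -- a blow-up of `ℙ³_K` along `Λ = ker Proj(f_K) = 𝓘(Σ)`
  obtain ⟨F₂, υ, hυ⟩ := exists_isBlowup (Proj (homogeneousSubmodule (Fin (1 + 2 + 1)) K)) (Proj.map fk hfk').ker
  have hΛ := WhitneyCubic.ker_projMap_kill_eq_vanishingIdeal_doubleLine K fk hfk' hfkC hfkX (WhitneyCubic.isClosed_doubleLine K)
  have hsupp := WhitneyCubic.support_ker_projMap_kill_eq_doubleLine K fk hfk' hfkC hfkX
  have hnot : ¬ (Set.range (hypersurfaceι F).left ⊆
      ((Proj.map fk hfk').ker.support : Set (Proj (homogeneousSubmodule (Fin (1 + 2 + 1)) K)))) := by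
    rw [hsupp]
    exact not_range_subset_of_notMem K F hF hprime hX2
  have hreg' : ∀ (Z : Scheme.{0}) (ρ : Z ⟶ (hypersurface F).left),
      IsBlowup ρ (((Proj.map fk hfk').ker).comap (hypersurfaceι F).left) → Scheme.IsRegular Z := by
    rw [hΛ]
    exact hreg
  -- the reduced strict transform is regular
  have hregST : Scheme.IsRegular (vanishingIdeal (⟨closure (υ ⁻¹' (Set.range (hypersurfaceι F).left \
      ((Proj.map fk hfk').ker.support : Set (Proj (homogeneousSubmodule (Fin (1 + 2 + 1)) K))))), isClosed_closure⟩ :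
      Closeds F₂)).subscheme :=
    EquisingularLift.StrataSplit.LinearCentre.isRegular_reducedStrictTransform_of_blowupModel (hypersurfaceι F).left
      (Proj.map fk hfk').ker hnot hreg' υ hυ
  rw [hsupp] at hregST
  rw [hΛ] at hυ
  exact reachNoseTowerBTriplePrime_of_oneBlowup K 3 _ (hypersurfaceι F).left _ (WhitneyCubic.isClosed_doubleLine K)
    (IsLiftableNoseClass₂.base _ (SkewLines.line_isLiftableNoseClass K 2 3 0 (by decide) (by decide) (by decide)))
    (subset_range_of_mem_span K F hmem) (not_range_subset_of_notMem K F hF hprime hX2) (WhitneyCubic.doubleLine_infinite K)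
    (WhitneyCubic.doubleLine_curve K) F₂ υ hυ hregST

/-! ## The same data feed the registered CI-nose rung: EL♮ for double-line hypersurfaces with regular blow-ups -/

/-- **The downstairs hypothesis of `stub_elnat_ciNoseThenPoints` at `n = 3`** for a prime form `F ∈ (x₂, x₃)` with `x₂ ∉ (F)` and regular blow-ups along
`𝓘⟨Σ⟩ · 𝒪_H`: witnesses `c = 2`, `f = (x₂, x₃)`, degrees `(1,1)`, a blow-up of `𝓘⟨Σ⟩`, ZERO point steps (pv-013's R2 certificate p522054, generic in `F`).
[OURS · L1 W4.5b] [folklore] -/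
theorem ciNoseThenPoints_hypothesis_of_isRegular_blowups (F : MvPolynomial (Fin 4) K) {e : ℕ} (hF : F.IsHomogeneous e) (hprime : Prime F)
    (hmem : F ∈ Ideal.span {(X 2 : MvPolynomial (Fin 4) K), X 3})
    (hX2 : (X 2 : MvPolynomial (Fin 4) K) ∉ Ideal.span {F})
    (hreg : ∀ (Z : Scheme.{0}) (ρ : Z ⟶ (hypersurface F).left),
      IsBlowup ρ ((vanishingIdeal (⟨_, WhitneyCubic.isClosed_doubleLine K⟩ :
        Closeds (Literature.AlgebraicGeometry.Motives.projectiveSpace 3 K).left)).comap (hypersurfaceι F).left) →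
      Scheme.IsRegular Z) :
    (letI := MvPolynomial.gradedAlgebra (σ := Fin (3 + 1)) (R := K); ∃ (c : ℕ) (f : Fin c → MvPolynomial (Fin (3 + 1)) K) (d : Fin c → ℕ), (∀ i, 1 ≤ d i ∧ f i ∈ MvPolynomial.homogeneousSubmodule (Fin (3 + 1)) K (d i)) ∧ Set.Nonempty {y : (Literature.AlgebraicGeometry.Motives.projectiveSpace 3 K).left | ∀ i, f i ∈ (y : ProjectiveSpectrum (MvPolynomial.homogeneousSubmodule (Fin (3 + 1)) K)).asHomogeneousIdeal} ∧ {y : (Literature.AlgebraicGeometry.Motives.projectiveSpace 3 K).left | ∀ i, f i ∈ (y : ProjectiveSpectrum (MvPolynomial.homogeneousSubmodule (Fin (3 + 1)) K)).asHomogeneousIdeal} ⊆ Set.range (Literature.AlgebraicGeometry.Motives.SmoothHypersurface.hypersurfaceι F).left ∧ ¬ (Set.range (Literature.AlgebraicGeometry.Motives.SmoothHypersurface.hypersurfaceι F).left ⊆ {y : (Literature.AlgebraicGeometry.Motives.projectiveSpace 3 K).left | ∀ i, f i ∈ (y : ProjectiveSpectrum (MvPolynomial.homogeneousSubmodule (Fin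 (3 + 1)) K)).asHomogeneousIdeal}) ∧ (∀ y ∈ {y : (Literature.AlgebraicGeometry.Motives.projectiveSpace 3 K).left | ∀ i, f i ∈ (y : ProjectiveSpectrum (MvPolynomial.homogeneousSubmodule (Fin (3 + 1)) K)).asHomogeneousIdeal}, ∃ e : Fin c ↪ Fin (3 + 1), Matrix.det (Matrix.of fun i j => MvPolynomial.pderiv (e j) (f i)) ∉ (y : ProjectiveSpectrum (MvPolynomial.homogeneousSubmodule (Fin (3 + 1)) K)).asHomogeneousIdeal) ∧ ∃ (hSig : IsClosed {y : (Literature.AlgebraicGeometry.Motives.projectiveSpace 3 K).left | ∀ i, f i ∈ (y : ProjectiveSpectrum (MvPolynomial.homogeneousSubmodule (Fin (3 + 1)) K)).asHomogeneousIdeal}) (F₂ : AlgebraicGeometry.Scheme.{0}) (υ : F₂ ⟶ (Literature.AlgebraicGeometry.Motives.projectiveSpace 3 K).left), Literature.AlgebraicGeometry.Resolution.IsBlowup υ (AlgebraicGeometry.Scheme.IdealSheafData.vanishingIdeal (⟨{y : (Literature.AlgebraicGeometry.Motives.projectiveSpace 3 K).left | ∀ i, f i ∈ (y : ProjectiveSpectrum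 (MvPolynomial.homogeneousSubmodule (Fin (3 + 1)) K)).asHomogeneousIdeal}, hSig⟩ : TopologicalSpace.Closeds (Literature.AlgebraicGeometry.Motives.projectiveSpace 3 K).left)) ∧ ∃ (F' : AlgebraicGeometry.Scheme.{0}) (ρ' : F' ⟶ F₂) (T' : Set F'), (∀ Q : (∀ F₁ : AlgebraicGeometry.Scheme.{0}, (F₁ ⟶ F₂) → Set F₁ → Prop), Q F₂ (CategoryTheory.CategoryStruct.id F₂) (closure (υ ⁻¹' (Set.range (Literature.AlgebraicGeometry.Motives.SmoothHypersurface.hypersurfaceι F).left \ {y : (Literature.AlgebraicGeometry.Motives.projectiveSpace 3 K).left | ∀ i, f i ∈ (y : ProjectiveSpectrum (MvPolynomial.homogeneousSubmodule (Fin (3 + 1)) K)).asHomogeneousIdeal}))) → (∀ (F₁ F₃ : AlgebraicGeometry.Scheme.{0}) (ρ : F₁ ⟶ F₂) (T₁ : Set F₁) (x : ↥((AlgebraicGeometry.Scheme.IdealSheafData.vanishingIdeal (⟨closure T₁, isClosed_closure⟩ : TopologicalSpace.Closeds F₁))).subscheme) (υ₁ : F₃ ⟶ F₁) (hx : IsClosed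 ({(((AlgebraicGeometry.Scheme.IdealSheafData.vanishingIdeal (⟨closure T₁, isClosed_closure⟩ : TopologicalSpace.Closeds F₁))).subschemeι x : F₁)} : Set F₁)), Q F₁ ρ T₁ → ¬ IsRegularLocalRing (((AlgebraicGeometry.Scheme.IdealSheafData.vanishingIdeal (⟨closure T₁, isClosed_closure⟩ : TopologicalSpace.Closeds F₁))).subscheme.presheaf.stalk x) → Literature.AlgebraicGeometry.Resolution.IsBlowup υ₁ (AlgebraicGeometry.Scheme.IdealSheafData.vanishingIdeal (⟨{(((AlgebraicGeometry.Scheme.IdealSheafData.vanishingIdeal (⟨closure T₁, isClosed_closure⟩ : TopologicalSpace.Closeds F₁))).subschemeι x : F₁)}, hx⟩ : TopologicalSpace.Closeds F₁)) → Q F₃ (CategoryTheory.CategoryStruct.comp υ₁ ρ) (closure (υ₁ ⁻¹' (T₁ \ {(((AlgebraicGeometry.Scheme.IdealSheafData.vanishingIdeal (⟨closure T₁, isClosed_closure⟩ : TopologicalSpace.Closeds F₁))).subschemeι x : F₁)})))) → Q F' ρ' T') ∧ Literature.AlgebraicGeometry.Resolution.Scheme.IsRegular (AlgebraicGeometry.Scheme.IdealSheafData.vanishingIdeal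 (⟨closure T', isClosed_closure⟩ : TopologicalSpace.Closeds F')).subscheme) := by
  classical
  obtain ⟨fk, hfk', hfkC, hfkX⟩ := EquisingularLift.StrataSplit.LinearCentre.exists_kill K 1 2
  haveI := isIntegral_hypersurface_of_prime K F hF hprime
  haveI : IsLocallyNoetherian (Literature.AlgebraicGeometry.Motives.projectiveSpace (2 + 1) K).left :=
    EquisingularLift.StrataSplit.LinearCentre.isLocallyNoetherian_proj K (1 + 2)
  obtain ⟨F₂, υ, hυ⟩ := exists_isBlowup (Proj (homogeneousSubmodule (Fin (1 + 2 + 1)) K)) (Proj.map fk hfk').ker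
  have hΛ := WhitneyCubic.ker_projMap_kill_eq_vanishingIdeal_doubleLine K fk hfk' hfkC hfkX (WhitneyCubic.isClosed_doubleLine K)
  have hsupp := WhitneyCubic.support_ker_projMap_kill_eq_doubleLine K fk hfk' hfkC hfkX
  have hnot : ¬ (Set.range (hypersurfaceι F).left ⊆
      ((Proj.map fk hfk').ker.support : Set (Proj (homogeneousSubmodule (Fin (1 + 2 + 1)) K)))) := by
    rw [hsupp]
    exact not_range_subset_of_notMem K F hF hprime hX2
  have hreg' : ∀ (Z : Scheme.{0}) (ρ : Z ⟶ (hypersurface F).left),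
      IsBlowup ρ (((Proj.map fk hfk').ker).comap (hypersurfaceι F).left) → Scheme.IsRegular Z := by
    rw [hΛ]
    exact hreg
  have hregST : Scheme.IsRegular (vanishingIdeal (⟨closure (υ ⁻¹' (Set.range (hypersurfaceι F).left \
      ((Proj.map fk hfk').ker.support : Set (Proj (homogeneousSubmodule (Fin (1 + 2 + 1)) K))))), isClosed_closure⟩ :
      Closeds F₂)).subscheme :=
    EquisingularLift.StrataSplit.LinearCentre.isRegular_reducedStrictTransform_of_blowupModel (hypersurfaceι F).left
      (Proj.map fk hfk').ker hnot hreg' υ hυ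
  refine ⟨2, ![X 2, X 3], ![1, 1], ?_, ⟨_, WhitneyCubic.genericPoint_mem_doubleLine K⟩, subset_range_of_mem_span K F hmem,
    not_range_subset_of_notMem K F hF hprime hX2, fun y _ => WhitneyCubic.jacobian_clause_doubleLine K y, WhitneyCubic.isClosed_doubleLine K,
    F₂, υ, ?_, F₂, 𝟙 F₂, _, fun Q h0 _ => h0, ?_⟩
  · intro i
    fin_cases i <;> exact ⟨le_rfl, (mem_homogeneousSubmodule _ _).mpr (isHomogeneous_X K _)⟩
  · rw [← hΛ]
    exact hυ
  · rw [hsupp] at hregST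
    have e' : (⟨closure (closure (υ ⁻¹' (Set.range (hypersurfaceι F).left \
        {y : (Literature.AlgebraicGeometry.Motives.projectiveSpace 3 K).left |
      ∀ i, (![X 2, X 3] : Fin 2 → MvPolynomial (Fin (3 + 1)) K) i ∈
        (y : ProjectiveSpectrum (MvPolynomial.homogeneousSubmodule (Fin (3 + 1)) K)).asHomogeneousIdeal}))),
        isClosed_closure⟩ : Closeds F₂) = ⟨closure (υ ⁻¹' (Set.range (hypersurfaceι F).left \
        {y : (Literature.AlgebraicGeometry.Motives.projectiveSpace 3 K).left |
      ∀ i, (![X 2, X 3] : Fin 2 → MvPolynomial (Fin (3 + 1)) K) i ∈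
        (y : ProjectiveSpectrum (MvPolynomial.homogeneousSubmodule (Fin (3 + 1)) K)).asHomogeneousIdeal})),
        isClosed_closure⟩ := Closeds.ext closure_closure
    have hreg'' : Scheme.IsRegular (vanishingIdeal (⟨closure (closure (υ ⁻¹' (Set.range (hypersurfaceι F).left \
        {y : (Literature.AlgebraicGeometry.Motives.projectiveSpace 3 K).left |
      ∀ i, (![X 2, X 3] : Fin 2 → MvPolynomial (Fin (3 + 1)) K) i ∈
        (y : ProjectiveSpectrum (MvPolynomial.homogeneousSubmodule (Fin (3 + 1)) K)).asHomogeneousIdeal}))),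
        isClosed_closure⟩ : Closeds F₂)).subscheme := by
      rw [e']
      exact hregST
    exact hreg''

/-- **EL♮ FOR EVERY DOUBLE-LINE HYPERSURFACE WITH REGULAR BLOW-UPS ALONG THE LINE, THROUGH THE REGISTERED RUNG** (`K` algebraically closed of
characteristic `p`, ANY `p`): for a prime form `F ∈ (x₂, x₃)` of positive degree with `x₂ ∉ (F)`, all four dehomogenisations `F(x_c := 1)` spanning radical
ideals, and every blow-up of `H = V₊(F)` along `𝓘⟨Σ⟩ · 𝒪_H` regular: `ELNatAt p K 3 H ι` — `stub_elnat_ciNoseThenPoints` (p524326) applied to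
`ciNoseThenPoints_hypothesis_of_isRegular_blowups`, the locally-principal binder by `HypersurfaceSpecimen.locallyPrincipal_hypersurfaceι`, then `elNatAt_of_horizAt`.
[OURS · L1 W4.5b] -/
theorem elNatAt_of_isRegular_blowups (p : ℕ) (hp : p.Prime) [CharP K p] [IsAlgClosed K]
    (F : MvPolynomial (Fin 4) K) {e : ℕ} (hF : F.IsHomogeneous e) (he : 0 < e) (hprime : Prime F)
    (hmem : F ∈ Ideal.span {(X 2 : MvPolynomial (Fin 4) K), X 3})
    (hX2 : (X 2 : MvPolynomial (Fin 4) K) ∉ Ideal.span {F})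
    (hrad : ∀ c : Fin (2 + 2), (Ideal.span {dehomogenize K c F}).radical = Ideal.span {dehomogenize K c F})
    (hreg : ∀ (Z : Scheme.{0}) (ρ : Z ⟶ (hypersurface F).left),
      IsBlowup ρ ((vanishingIdeal (⟨_, WhitneyCubic.isClosed_doubleLine K⟩ :
        Closeds (Literature.AlgebraicGeometry.Motives.projectiveSpace 3 K).left)).comap (hypersurfaceι F).left) →
      Scheme.IsRegular Z) :
    Theorems.EquisingularLift.ELNatAt p K 3 (hypersurface F).left (hypersurfaceι F).left := by
  haveI := isIntegral_hypersurface_of_prime K F hF hprime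
  exact Summit.ResolutionOfSingularities.ResolutionOfSingularities.Theorems.EquisingularLiftNatResidualCut.elNatAt_of_horizAt
    p K 3 _ _ inferInstance inferInstance
    (stub_elnat_ciNoseThenPoints p hp K 3 _ _ inferInstance inferInstance
      (HypersurfaceSpecimen.locallyPrincipal_hypersurfaceι F hF he hrad)
      (ciNoseThenPoints_hypothesis_of_isRegular_blowups K F hF hprime hmem hX2 hreg))

end DoubleLine

end Summit.ResolutionOfSingularities.ResolutionOfSingularities.Cruxes.EquisingularLiftNat.Sections

end
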